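import Literature.Probability.Percolation.OneArmAnnulusCrossingProofs
import HarnessLib

/-!
# LSW's (3.1): scale coherence, and convergence along one geometric sequence of scales (proofs only)

Topic `Literature/Probability/Percolation`; family `crit-perc`. Def-free, fact-free sequel of
`OneArmAnnulusCrossingProofs.lean`, about the named fact
`Literature.Probability.Percolation.LawlerSchrammWerner2002_annulusCrossing` (Lawler–Schramm–Werner,
*One-arm exponent for critical 2D percolation*, Electron. J. Probab. **7** (2002), paper no. 2,
**Theorem 1.2** (p. 2) with **(3.1)** (p. 8)): there is ONE function `u` with
`log u(r) / log r → 5/48` and, for every `r ∈ (0, 1/2)` and all `R ≥ s₀(r)`,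
`u(r/2)/2 ≤ P[C(rR, R)] ≤ 2 u(2r)`, `C(R₁, R₂)` the open crossing of the annulus of radii
`R₁ < R₂` about `0` by critical site percolation on `𝕋` (`triOpenCrossing`). Write
`p(r, R) = P[C(rR, R)]`.

`OneArmAnnulusCrossingProofs.lean` proved the fact from uniform power bounds
`C⁻¹ r^{5/48}/2 ≤ p(r, R) ≤ 2 C r^{5/48}` (what LSW §2 gives at subsequential scaling limits;
in the tree from the subsequential hitting-PDE hypotheses, from the trace identification, or from
Neumann flatness of the renewal extension — `OneArmSubsequentialLimits.lean`, `OneArmFromTrace.lean`,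
`OneArmScalingLimitFromNeumann.lean`) plus *radial convergence*: the existence of
`lim_{R → ∞} p(r, R)` for all radii off a countable set. This file determines how much of that
convergence (3.1) really uses.

* `LawlerSchrammWerner2002_annulusCrossing.coherence`, `….limsup_le_liminf` — NECESSITY: the fact
  forces, for every `r ∈ (0, 1/8)`, `p(r, R) ≤ 4 p(4r, R')` for all large `R, R'`, hence
  `limsup_R p(r, R) ≤ 4 liminf_R p(4r, R)`: the one function `u` ties the crossing probabilities at
  UNRELATED scales `R, R'` together ("scale coherence"). Bounds at subsequential limits alone
  compare `p(r, ·)` and `p(4r, ·)` only up to the non-explicit constant `4C²`, which is why the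
  fact — unlike the one-arm exponent itself (`oneArm_exponent_of_subseqHittingPDE`) — is not a
  consequence of LSW §2 at subsequential limits and needs some convergence input.
* `LawlerSchrammWerner2002_annulusCrossing_of_crossingBounds_of_coherence` — SHARP SUFFICIENCY:
  the uniform power bounds and strict coherence `limsup_R p(r, R) < 4 liminf_R p(4r, R)`
  (`r ∈ (0, 1/8)`) give the fact, with `u(s) = √(limsup p(s/2, ·) · liminf p(2s, ·))` for
  `s < 1/4` (the geometric mean of the two envelopes `u` has to separate) and `u(s) = 1` for
  `s ≥ 1/4`.
* `limsup_le_of_tendsto_seq_triOpenCrossing`, `le_liminf_of_tendsto_seq_triOpenCrossing` — the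
  monotonicity of `C(R₁, R₂)` in its radii compares ALL scales with ONE sequence of scales: if
  `R_k → ∞` and `p(s, R_k) → q`, then `limsup_R p(ρ, R) ≤ q` as soon as `ρ R_{k+1} ≤ s R_k`, and
  `q ≤ liminf_R p(ρ', R)` as soon as `s R_{k+1} ≤ ρ' R_k` (for `R_k ≤ R < R_{k+1}`,
  `C(ρR, R) ⊆ C(sR_k, R_k)` and `C(sR_{k+1}, R_{k+1}) ⊆ C(ρ'R, R)`).
* `LawlerSchrammWerner2002_annulusCrossing_of_crossingBounds_of_tendsto_seq` — hence the fact from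
  the uniform power bounds and the convergence of `p(s, R_k)` (`k → ∞`) along ONE sequence of
  scales `R_k → ∞` with bounded ratios `R_{k+1} ≤ M R_k`, `1 ≤ M < 2`, for all `s ∈ (0, 1/2)` off
  a countable set (window `s ∈ [Mρ, 4ρ/M]`; the factor `4` of (3.1) absorbs the ratio `M² < 4`);
  `…_of_tendsto_seq_two`, `…_of_tendsto_dyadic` — ratio `2` (e.g. `R_k = 2^k`) with convergence at
  every `s ∈ (0, 1/4)` (degenerate window `s = 2ρ`).
* `tendsto_real_triOpenCrossing_seq_of_tendsto_lswLaw` — weak convergence of the hull laws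
  `lswLaw (R_k) → ν` gives `p(s, R_k) → ν{dist(0, K) < s}` for `s ∈ (0, 1)` off the atoms of
  `dist(0, K)` under `ν` (portmanteau, Billingsley Thm. 2.1), so:
* `LawlerSchrammWerner2002_annulusCrossing_of_crossingBounds_of_tendsto_lswLaw_seq`,
  `LawlerSchrammWerner2002_annulusCrossing_of_subseqHittingPDE_of_tendsto_lswLaw_seq` — **the fact
  from LSW §2 at subsequential limits and the weak convergence of `lswLaw (R_k)` along ONE
  sequence `R_k → ∞` with `R_{k+1} ≤ M R_k`, `M < 2`** (e.g. `R_k = (3/2)^k`), instead of the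
  scaling limit `R → ∞` through `ℝ` (LSW p. 3, "the limit exists"). Tightness
  (`isCompact_closure_range_lswLaw`) gives convergent SUBsequences of any sequence, but passing to
  a subsequence destroys the ratio bound, so this is still a uniqueness statement about the
  scaling limit (Smirnov 2001 / Camia–Newman 2006 as LSW use them, p. 3), only a formally weaker
  one.

What is NOT here: no discharge; no new definitions; no new named facts.

## References

* G. F. Lawler, O. Schramm, W. Werner, *One-arm exponent for critical 2D percolation*, Electron.
  J. Probab. 7 (2002), no. 2 — Thm. 1.2 (p. 2), §2 (p. 3), §3 (3.1) (p. 8), p. 9 first line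
  [LawlerSchrammWernerEJP2002].
* P. Billingsley, *Convergence of Probability Measures*, 2nd ed. (1999), Thm. 2.1 (portmanteau)
  [Billingsley1999].

## Mathlib / tree

Mathlib: `Filter.limsup_le_of_le`, `Filter.le_liminf_of_le`, `Filter.liminf_le_limsup`,
`Filter.eventually_lt_of_limsup_lt`, `Filter.eventually_lt_of_lt_liminf`, `le_of_forall_pos_le_add`,
`Nat.find`, `Cardinal.Real.Icc_countable_iff`,
`ProbabilityMeasure.tendsto_measure_of_null_frontier_of_tendsto'`.
Tree: `triAnnulusCrossing_mono` (`TriAnnulusCrossing.lean`), `tendsto_log_div_log_of_rpow_bounds`,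
`real_triOpenCrossing_eq` (`OneArmScalingLimit.lean`), `crossingBounds_of_subseqLimits`,
`continuous_infDist_zero_nonemptyCompacts` (`OneArmSubsequentialLimits.lean` / `OneArmScalingLimit.lean`),
`IsHittingPDEData.measure_bounds`, `koebeCovering_const`.
-/

noncomputable section

open MeasureTheory Filter Topology Metric Set TopologicalSpace
open Literature.Probability.LatticeModels Literature.Probability.Percolation
open scoped ENNReal NNReal

namespace Literature.Probability.Percolation

/-! ### Necessity: one `u` in (3.1) forces scale coherence -/

/-- **(3.1) forces scale coherence.** If `LawlerSchrammWerner2002_annulusCrossing` holds then for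
every `r ∈ (0, 1/8)` there is `S` with `P[C(rR, R)] ≤ 4 P[C(4rR', R')]` for all `R, R' ≥ S`: the
upper bound of (3.1) at `r` is `2 u(2r)` and the lower bound at `4r` is `u(2r)/2`.
[cite: LawlerSchrammWernerEJP2002, §3 (3.1) (p. 8)] -/
theorem LawlerSchrammWerner2002_annulusCrossing.coherence
    (h : LawlerSchrammWerner2002_annulusCrossing) {r : ℝ} (hr0 : 0 < r) (hr8 : r < 1 / 8) :
    ∃ S : ℝ, ∀ R R' : ℝ, S ≤ R → S ≤ R' →
      (triSitePercolation half).real (triOpenCrossing (r * R) R) ≤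
        4 * (triSitePercolation half).real (triOpenCrossing (4 * r * R') R') := by
  obtain ⟨u, -, h31⟩ := h
  obtain ⟨s₀, hs₀⟩ := h31 r hr0 (by linarith)
  obtain ⟨s₁, hs₁⟩ := h31 (4 * r) (by positivity) (by linarith)
  refine ⟨max s₀ s₁, fun R R' hR hR' => ?_⟩
  have hup := (hs₀ R ((le_max_left _ _).trans hR)).2
  have hlow := (hs₁ R' ((le_max_right _ _).trans hR')).1
  rw [show 4 * r / 2 = 2 * r by ring] at hlow
  linarith

/-- **(3.1) forces `limsup_R P[C(rR, R)] ≤ 4 liminf_R P[C(4rR, R)]`** for `r ∈ (0, 1/8)`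
(`LawlerSchrammWerner2002_annulusCrossing.coherence` in `limsup`/`liminf` form).
[cite: LawlerSchrammWernerEJP2002, §3 (3.1) (p. 8)] -/
theorem LawlerSchrammWerner2002_annulusCrossing.limsup_le_liminf
    (h : LawlerSchrammWerner2002_annulusCrossing) {r : ℝ} (hr0 : 0 < r) (hr8 : r < 1 / 8) :
    limsup (fun R : ℝ => (triSitePercolation half).real (triOpenCrossing (r * R) R)) atTop ≤
      4 * liminf (fun R : ℝ => (triSitePercolation half).real (triOpenCrossing (4 * r * R) R))
        atTop := by
  obtain ⟨S, hS⟩ := h.coherence hr0 hr8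
  have hcobdd : IsCoboundedUnder (· ≤ ·) atTop
      (fun R : ℝ => (triSitePercolation half).real (triOpenCrossing (r * R) R)) :=
    isCoboundedUnder_le_of_le atTop fun _ => measureReal_nonneg
  have hcobdd' : IsCoboundedUnder (· ≥ ·) atTop
      (fun R : ℝ => (triSitePercolation half).real (triOpenCrossing (4 * r * R) R)) :=
    isCoboundedUnder_ge_of_le atTop fun _ => measureReal_le_one
  have h1 : ∀ R', S ≤ R' →
      limsup (fun R : ℝ => (triSitePercolation half).real (triOpenCrossing (r * R) R)) atTop ≤
        4 * (triSitePercolation half).real (triOpenCrossing (4 * r * R') R') := fun R' hR' =>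
    limsup_le_of_le hcobdd ((eventually_ge_atTop S).mono fun R hR => hS R R' hR hR')
  have h2 : limsup (fun R : ℝ => (triSitePercolation half).real (triOpenCrossing (r * R) R)) atTop
      / 4 ≤ liminf (fun R : ℝ => (triSitePercolation half).real (triOpenCrossing (4 * r * R) R))
        atTop :=
    le_liminf_of_le hcobdd' ((eventually_ge_atTop S).mono fun R' hR' => by
      have := h1 R' hR'
      linarith)
  linarith

/-! ### Sharp sufficiency: uniform power bounds and strict coherence -/

/-- **LSW's Thm. 1.2 + (3.1) from uniform power bounds and strict scale coherence** (sharp form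
of `LawlerSchrammWerner2002_annulusCrossing_of_crossingBounds_of_tendsto`). Suppose one constant
`C > 0` gives `C⁻¹ r^{5/48}/2 ≤ P[C(rR, R)] ≤ 2 C r^{5/48}` for every `r ∈ (0, 1/2)` and all
large `R` (the output of `crossingBounds_of_subseqLimits`), and for every `r ∈ (0, 1/8)`,
`limsup_R P[C(rR, R)] < 4 liminf_R P[C(4rR, R)]`. Then `LawlerSchrammWerner2002_annulusCrossing`
holds with `u(s) = √(limsup_R P[C(sR/2, R)] · liminf_R P[C(2sR, R)])` for `s < 1/4`, `u(s) = 1`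
for `s ≥ 1/4`: both halves of (3.1) at `r` reduce to the coherence inequality (at `r/4`, resp.
at `r`), and `u(s) ≍ s^{5/48}` gives "`log u(r)/log r → 5/48`" (p. 9).
[cite: LawlerSchrammWernerEJP2002, Thm. 1.2 (p. 2), (3.1) (p. 8) and p. 9] -/
theorem LawlerSchrammWerner2002_annulusCrossing_of_crossingBounds_of_coherence {C : ℝ} (hC : 0 < C)
    (hb : ∀ r : ℝ, 0 < r → r < 1 / 2 → ∃ s₀ : ℝ, ∀ R : ℝ, s₀ ≤ R →
      C⁻¹ * r ^ (5 / 48 : ℝ) / 2 ≤ (triSitePercolation half).real (triOpenCrossing (r * R) R) ∧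
        (triSitePercolation half).real (triOpenCrossing (r * R) R) ≤ 2 * (C * r ^ (5 / 48 : ℝ)))
    (hcoh : ∀ r : ℝ, 0 < r → r < 1 / 8 →
      limsup (fun R : ℝ => (triSitePercolation half).real (triOpenCrossing (r * R) R)) atTop <
        4 * liminf (fun R : ℝ => (triSitePercolation half).real (triOpenCrossing (4 * r * R) R))
          atTop) :
    LawlerSchrammWerner2002_annulusCrossing := by
  -- `p r R = P[C(rR, R)]`, `P r = limsup_R p r R`, `m r = liminf_R p r R`
  set p : ℝ → ℝ → ℝ := fun r R => (triSitePercolation half).real (triOpenCrossing (r * R) R)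
    with hp
  set P : ℝ → ℝ := fun r => limsup (p r) atTop with hP
  set m : ℝ → ℝ := fun r => liminf (p r) atTop with hm
  have hbdd : ∀ r, IsBoundedUnder (· ≤ ·) atTop (p r) := fun r =>
    isBoundedUnder_of ⟨1, fun _ => measureReal_le_one⟩
  have hbdd' : ∀ r, IsBoundedUnder (· ≥ ·) atTop (p r) := fun r =>
    isBoundedUnder_of ⟨0, fun _ => measureReal_nonneg⟩
  have hcobdd : ∀ r, IsCoboundedUnder (· ≤ ·) atTop (p r) := fun r =>
    isCoboundedUnder_le_of_le atTop fun _ => measureReal_nonneg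
  have hcobdd' : ∀ r, IsCoboundedUnder (· ≥ ·) atTop (p r) := fun r =>
    isCoboundedUnder_ge_of_le atTop fun _ => measureReal_le_one
  have hmP : ∀ r, m r ≤ P r := fun r => liminf_le_limsup (hbdd r) (hbdd' r)
  -- the coherence hypothesis in terms of the envelopes
  have key : ∀ r, 0 < r → r < 1 / 8 → P r < 4 * m (4 * r) := fun r hr0 hr8 => hcoh r hr0 hr8
  -- the power bounds pass to the envelopes
  have hbds : ∀ r, 0 < r → r < 1 / 2 →
      C⁻¹ / 2 * r ^ (5 / 48 : ℝ) ≤ m r ∧ P r ≤ 2 * C * r ^ (5 / 48 : ℝ) := by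
    intro r hr0 hr2
    obtain ⟨s₀, hs₀⟩ := hb r hr0 hr2
    have hev : ∀ᶠ R in atTop, C⁻¹ * r ^ (5 / 48 : ℝ) / 2 ≤ p r R ∧
        p r R ≤ 2 * (C * r ^ (5 / 48 : ℝ)) :=
      (eventually_ge_atTop s₀).mono fun R hR => hs₀ R hR
    constructor
    · calc C⁻¹ / 2 * r ^ (5 / 48 : ℝ) = C⁻¹ * r ^ (5 / 48 : ℝ) / 2 := by ring
        _ ≤ m r := le_liminf_of_le (hcobdd' r) (hev.mono fun R h => h.1)
    · calc P r ≤ 2 * (C * r ^ (5 / 48 : ℝ)) := limsup_le_of_le (hcobdd r) (hev.mono fun R h => h.2)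
        _ = 2 * C * r ^ (5 / 48 : ℝ) := by ring
  have hmpos : ∀ r, 0 < r → r < 1 / 2 → 0 < m r := fun r hr0 hr2 =>
    lt_of_lt_of_le (by positivity) (hbds r hr0 hr2).1
  have hPpos : ∀ r, 0 < r → r < 1 / 2 → 0 < P r := fun r hr0 hr2 =>
    (hmpos r hr0 hr2).trans_le (hmP r)
  -- LSW's `u`: the geometric mean of the two envelopes it has to separate
  set u : ℝ → ℝ := fun s => if s < 1 / 4 then Real.sqrt (P (s / 2) * m (2 * s)) else 1 with hu
  refine ⟨u, ?_, fun r hr0 hr2 => ?_⟩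
  · -- "By Theorem 1.2, `log u(r) / log r → 5/48`": `C⁻¹/2 · s^{5/48} ≤ u(s) ≤ 2C · s^{5/48}`
    refine tendsto_log_div_log_of_rpow_bounds (L := C⁻¹ / 2) (U := 2 * C) (δ := 1 / 4)
      (by positivity) (by positivity) (by norm_num) fun s hs0 hs4 => ?_
    have hu_eq : u s = Real.sqrt (P (s / 2) * m (2 * s)) := by
      simp only [hu]
      rw [if_pos hs4]
    have hsa : (s / 2) ^ (5 / 48 : ℝ) * (2 * s) ^ (5 / 48 : ℝ) =
        s ^ (5 / 48 : ℝ) * s ^ (5 / 48 : ℝ) := by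
      rw [← Real.mul_rpow (by positivity) (by positivity), ← Real.mul_rpow hs0.le hs0.le]
      congr 1
      ring
    have h1 := hbds (s / 2) (by positivity) (by linarith)
    have h2 := hbds (2 * s) (by positivity) (by linarith)
    have hm1 : 0 ≤ m (s / 2) := (hmpos (s / 2) (by positivity) (by linarith)).le
    have hm2 : 0 ≤ m (2 * s) := (hmpos (2 * s) (by positivity) (by linarith)).le
    have hP1 : 0 ≤ P (s / 2) := (hPpos (s / 2) (by positivity) (by linarith)).le
    have hP2 : 0 ≤ P (2 * s) := (hPpos (2 * s) (by positivity) (by linarith)).le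
    have hLs : 0 ≤ C⁻¹ / 2 * s ^ (5 / 48 : ℝ) := by positivity
    have hUs : 0 ≤ 2 * C * s ^ (5 / 48 : ℝ) := by positivity
    rw [hu_eq]
    constructor
    · have hsq : (C⁻¹ / 2 * s ^ (5 / 48 : ℝ)) ^ 2 ≤ P (s / 2) * m (2 * s) :=
        calc (C⁻¹ / 2 * s ^ (5 / 48 : ℝ)) ^ 2
            = (C⁻¹ / 2) ^ 2 * (s ^ (5 / 48 : ℝ) * s ^ (5 / 48 : ℝ)) := by ring
          _ = (C⁻¹ / 2) ^ 2 * ((s / 2) ^ (5 / 48 : ℝ) * (2 * s) ^ (5 / 48 : ℝ)) := by rw [hsa]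
          _ = (C⁻¹ / 2 * (s / 2) ^ (5 / 48 : ℝ)) * (C⁻¹ / 2 * (2 * s) ^ (5 / 48 : ℝ)) := by ring
          _ ≤ m (s / 2) * m (2 * s) := mul_le_mul h1.1 h2.1 (by positivity) hm1
          _ ≤ P (s / 2) * m (2 * s) := mul_le_mul_of_nonneg_right (hmP _) hm2
      calc C⁻¹ / 2 * s ^ (5 / 48 : ℝ) = Real.sqrt ((C⁻¹ / 2 * s ^ (5 / 48 : ℝ)) ^ 2) :=
            (Real.sqrt_sq hLs).symm
        _ ≤ Real.sqrt (P (s / 2) * m (2 * s)) := Real.sqrt_le_sqrt hsq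
    · have hsq : P (s / 2) * m (2 * s) ≤ (2 * C * s ^ (5 / 48 : ℝ)) ^ 2 :=
        calc P (s / 2) * m (2 * s) ≤ P (s / 2) * P (2 * s) :=
              mul_le_mul_of_nonneg_left (hmP _) hP1
          _ ≤ (2 * C * (s / 2) ^ (5 / 48 : ℝ)) * (2 * C * (2 * s) ^ (5 / 48 : ℝ)) :=
              mul_le_mul h1.2 h2.2 hP2 (by positivity)
          _ = (2 * C) ^ 2 * ((s / 2) ^ (5 / 48 : ℝ) * (2 * s) ^ (5 / 48 : ℝ)) := by ring
          _ = (2 * C) ^ 2 * (s ^ (5 / 48 : ℝ) * s ^ (5 / 48 : ℝ)) := by rw [hsa]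
          _ = (2 * C * s ^ (5 / 48 : ℝ)) ^ 2 := by ring
      calc Real.sqrt (P (s / 2) * m (2 * s)) ≤ Real.sqrt ((2 * C * s ^ (5 / 48 : ℝ)) ^ 2) :=
            Real.sqrt_le_sqrt hsq
        _ = 2 * C * s ^ (5 / 48 : ℝ) := Real.sqrt_sq hUs
  · -- (3.1) at `r ∈ (0, 1/2)`.  Lower bound: `u(r/2) = √(P(r/4) m(r))` and `√(P(r/4) m(r))/2 < m(r)`
    have hr4 : r / 2 < 1 / 4 := by linarith
    have hu_half : u (r / 2) = Real.sqrt (P (r / 4) * m r) := by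
      simp only [hu]
      rw [if_pos hr4, show r / 2 / 2 = r / 4 by ring, show (2 : ℝ) * (r / 2) = r by ring]
    have hmr := hmpos r hr0 hr2
    have hP4 : 0 ≤ P (r / 4) := (hPpos (r / 4) (by positivity) (by linarith)).le
    have hcoh1 : P (r / 4) < 4 * m r := by
      have := key (r / 4) (by positivity) (by linarith)
      rwa [show (4 : ℝ) * (r / 4) = r by ring] at this
    have hlow_lt : Real.sqrt (P (r / 4) * m r) / 2 < m r := by
      have hsq : P (r / 4) * m r < (2 * m r) ^ 2 := by nlinarith
      have h := Real.sqrt_lt_sqrt (mul_nonneg hP4 hmr.le) hsq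
      rw [Real.sqrt_sq (by positivity)] at h
      linarith
    have hlow : ∀ᶠ R in atTop, u (r / 2) / 2 < p r R := by
      rw [hu_half]
      exact eventually_lt_of_lt_liminf hlow_lt (hbdd' r)
    -- Upper bound: for `r < 1/8`, `u(2r) = √(P(r) m(4r))` and `P(r) < 2 √(P(r) m(4r))`;
    -- for `r ≥ 1/8`, `u(2r) = 1 ≥ P[·]/2` trivially
    have hup : ∀ᶠ R in atTop, p r R ≤ 2 * u (2 * r) := by
      rcases lt_or_ge r (1 / 8) with hr8 | hr8
      · have h2r : 2 * r < 1 / 4 := by linarith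
        have hu_two : u (2 * r) = Real.sqrt (P r * m (4 * r)) := by
          simp only [hu]
          rw [if_pos h2r, show (2 : ℝ) * r / 2 = r by ring, show (2 : ℝ) * (2 * r) = 4 * r by ring]
        have hPr := hPpos r hr0 hr2
        have hm4 : 0 ≤ m (4 * r) := (hmpos (4 * r) (by positivity) (by linarith)).le
        have hcoh2 : P r < 4 * m (4 * r) := key r hr0 hr8
        have hup_lt : P r < 2 * Real.sqrt (P r * m (4 * r)) := by
          have hsq : P r ^ 2 < P r * m (4 * r) * 4 := by nlinarith
          have h := Real.sqrt_lt_sqrt (by positivity) hsq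
          rw [Real.sqrt_sq hPr.le, Real.sqrt_mul (mul_nonneg hPr.le hm4),
            show Real.sqrt (4 : ℝ) = 2 by
              rw [show (4 : ℝ) = 2 ^ 2 by norm_num, Real.sqrt_sq (by norm_num)]] at h
          linarith
        rw [hu_two]
        exact (eventually_lt_of_limsup_lt hup_lt (hbdd r)).mono fun R h => h.le
      · have h2r : ¬ 2 * r < 1 / 4 := by linarith
        have hu_two : u (2 * r) = 1 := by
          simp only [hu]
          rw [if_neg h2r]
        rw [hu_two]
        exact Eventually.of_forall fun R => (measureReal_le_one).trans (by norm_num)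
    obtain ⟨s₀, hs₀⟩ := eventually_atTop.1 (hlow.and hup)
    exact ⟨s₀, fun R hR => ⟨(hs₀ R hR).1.le, (hs₀ R hR).2⟩⟩

/-! ### All scales from one sequence of scales -/

/-- For a real sequence `R_k → ∞` and an index `k₀`, every large real `R` lies in some
`[R_k, R_{k+1})` with `k ≥ k₀` (take `k + 1` the least index from which on `R_j > R`).
[folklore] -/
theorem eventually_exists_index_mem_Ico {R_ : ℕ → ℝ} (hR : Tendsto R_ atTop atTop) (k₀ : ℕ) :
    ∀ᶠ R : ℝ in atTop, ∃ k : ℕ, k₀ ≤ k ∧ R_ k ≤ R ∧ R < R_ (k + 1) := by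
  have hall : ∀ᶠ R : ℝ in atTop, ∀ j ∈ Finset.range (k₀ + 1), R_ j ≤ R :=
    (eventually_all_finset _).2 fun j _ => eventually_ge_atTop (R_ j)
  filter_upwards [hall] with R hR'
  classical
  have hex : ∃ K : ℕ, ∀ j, K ≤ j → R < R_ j := by
    obtain ⟨K, hK⟩ := eventually_atTop.1 (hR.eventually_gt_atTop R)
    exact ⟨K, hK⟩
  have hKspec : ∀ j, Nat.find hex ≤ j → R < R_ j := Nat.find_spec hex
  have hk₀K : k₀ < Nat.find hex := by
    by_contra hle
    push Not at hle
    have h1 := hKspec (Nat.find hex) le_rfl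
    have h2 := hR' (Nat.find hex) (Finset.mem_range.2 (by omega))
    linarith
  refine ⟨Nat.find hex - 1, by omega, ?_, ?_⟩
  · by_contra hlt
    push Not at hlt
    have hmin := Nat.find_min hex (show Nat.find hex - 1 < Nat.find hex by omega)
    apply hmin
    intro j hj
    rcases eq_or_lt_of_le hj with h | h
    · rw [← h]
      exact hlt
    · exact hKspec j (by omega)
  · exact hKspec (Nat.find hex - 1 + 1) (by omega)

/-- **One sequence of scales bounds all scales from above.** If `R_k → ∞`, eventually
`ρ R_{k+1} ≤ s R_k` (`ρ ≥ 0`), and `P[C(sR_k, R_k)] → q`, then `limsup_R P[C(ρR, R)] ≤ q`: for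
`R_k ≤ R < R_{k+1}` the annulus event is monotone, `C(ρR, R) ⊆ C(sR_k, R_k)` (`ρR ≤ sR_k`,
`R_k ≤ R`; `triAnnulusCrossing_mono`). [folklore] -/
theorem limsup_le_of_tendsto_seq_triOpenCrossing {ρ s : ℝ} (hρ : 0 ≤ ρ) {R_ : ℕ → ℝ}
    (hR : Tendsto R_ atTop atTop) (h1 : ∀ᶠ k in atTop, ρ * R_ (k + 1) ≤ s * R_ k) {q : ℝ}
    (hq : Tendsto (fun k => (triSitePercolation half).real (triOpenCrossing (s * R_ k) (R_ k)))
      atTop (𝓝 q)) :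
    limsup (fun R : ℝ => (triSitePercolation half).real (triOpenCrossing (ρ * R) R)) atTop ≤ q := by
  refine le_of_forall_pos_le_add fun ε hε => ?_
  refine limsup_le_of_le (isCoboundedUnder_le_of_le atTop fun _ => measureReal_nonneg) ?_
  have hev : ∀ᶠ k in atTop, ρ * R_ (k + 1) ≤ s * R_ k ∧
      (triSitePercolation half).real (triOpenCrossing (s * R_ k) (R_ k)) < q + ε :=
    h1.and (hq.eventually (gt_mem_nhds (by linarith)))
  obtain ⟨k₀, hk₀⟩ := eventually_atTop.1 hev
  filter_upwards [eventually_exists_index_mem_Ico hR k₀] with R ⟨k, hk, hRk, hRk1⟩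
  obtain ⟨hrat, hlt⟩ := hk₀ k hk
  have hsub : triOpenCrossing (ρ * R) R ⊆ triOpenCrossing (s * R_ k) (R_ k) :=
    triAnnulusCrossing_mono ((mul_le_mul_of_nonneg_left hRk1.le hρ).trans hrat) hRk
  exact (measureReal_mono hsub (measure_ne_top _ _)).trans hlt.le

/-- **One sequence of scales bounds all scales from below.** If `R_k → ∞`, eventually
`s R_{k+1} ≤ ρ R_k` (`ρ ≥ 0`), and `P[C(sR_k, R_k)] → q`, then `q ≤ liminf_R P[C(ρR, R)]`: for
`R_k ≤ R < R_{k+1}`, `C(sR_{k+1}, R_{k+1}) ⊆ C(ρR, R)` (`sR_{k+1} ≤ ρR`, `R ≤ R_{k+1}`).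
[folklore] -/
theorem le_liminf_of_tendsto_seq_triOpenCrossing {ρ s : ℝ} (hρ : 0 ≤ ρ) {R_ : ℕ → ℝ}
    (hR : Tendsto R_ atTop atTop) (h2 : ∀ᶠ k in atTop, s * R_ (k + 1) ≤ ρ * R_ k) {q : ℝ}
    (hq : Tendsto (fun k => (triSitePercolation half).real (triOpenCrossing (s * R_ k) (R_ k)))
      atTop (𝓝 q)) :
    q ≤ liminf (fun R : ℝ => (triSitePercolation half).real (triOpenCrossing (ρ * R) R)) atTop := by
  refine le_of_forall_pos_le_add fun ε hε => ?_
  suffices h : q - ε ≤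
      liminf (fun R : ℝ => (triSitePercolation half).real (triOpenCrossing (ρ * R) R)) atTop by
    linarith
  refine le_liminf_of_le (isCoboundedUnder_ge_of_le atTop fun _ => measureReal_le_one) ?_
  have hev : ∀ᶠ k in atTop, s * R_ (k + 1) ≤ ρ * R_ k ∧
      q - ε < (triSitePercolation half).real (triOpenCrossing (s * R_ k) (R_ k)) :=
    h2.and (hq.eventually (lt_mem_nhds (by linarith)))
  obtain ⟨k₀, hk₀⟩ := eventually_atTop.1 hev
  filter_upwards [eventually_exists_index_mem_Ico hR k₀] with R ⟨k, hk, hRk, hRk1⟩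
  have hrat := (hk₀ k hk).1
  have hlt := (hk₀ (k + 1) (by omega)).2
  have hsub : triOpenCrossing (s * R_ (k + 1)) (R_ (k + 1)) ⊆ triOpenCrossing (ρ * R) R :=
    triAnnulusCrossing_mono (hrat.trans (mul_le_mul_of_nonneg_left hRk hρ)) hRk1.le
  exact hlt.le.trans (measureReal_mono hsub (measure_ne_top _ _))

/-- Strict coherence at `ρ` from a common value `q` with `limsup_R P[C(ρR, R)] ≤ q ≤
liminf_R P[C(4ρR, R)]` and a positive eventual lower bound for `P[C(ρR, R)]` (then `q > 0`).
[folklore] -/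
theorem coherence_of_limsup_le_of_le_liminf {ρ q ℓ : ℝ} (hℓ : 0 < ℓ)
    (hlow : ∀ᶠ R : ℝ in atTop, ℓ ≤ (triSitePercolation half).real (triOpenCrossing (ρ * R) R))
    (hup : limsup (fun R : ℝ => (triSitePercolation half).real (triOpenCrossing (ρ * R) R)) atTop
      ≤ q)
    (hq : q ≤
      liminf (fun R : ℝ => (triSitePercolation half).real (triOpenCrossing (4 * ρ * R) R)) atTop) :
    limsup (fun R : ℝ => (triSitePercolation half).real (triOpenCrossing (ρ * R) R)) atTop <
      4 * liminf (fun R : ℝ => (triSitePercolation half).real (triOpenCrossing (4 * ρ * R) R))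
        atTop := by
  have hℓ' : ℓ ≤ limsup (fun R : ℝ => (triSitePercolation half).real (triOpenCrossing (ρ * R) R))
      atTop :=
    le_limsup_of_frequently_le hlow.frequently (isBoundedUnder_of ⟨1, fun _ => measureReal_le_one⟩)
  linarith

/-- **LSW's Thm. 1.2 + (3.1) from uniform power bounds and convergence along one sequence of
scales with ratios `< 2`.** Suppose the uniform power bounds of
`LawlerSchrammWerner2002_annulusCrossing_of_crossingBounds_of_coherence`, and let `R_k → ∞` with
`R_{k+1} ≤ M R_k` eventually, `1 ≤ M < 2`. If `P[C(sR_k, R_k)]` converges as `k → ∞` for every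
`s ∈ (0, 1/2)` off a countable set `N`, then `LawlerSchrammWerner2002_annulusCrossing` holds: for
`ρ ∈ (0, 1/8)` pick such an `s` in the window `[Mρ, 4ρ/M]` (uncountable as `M² < 4`); then
`ρ R_{k+1} ≤ s R_k` and `s R_{k+1} ≤ 4ρ R_k`, so
`limsup_R P[C(ρR, R)] ≤ lim_k P[C(sR_k, R_k)] ≤ liminf_R P[C(4ρR, R)]`, which is strict
coherence. [cite: LawlerSchrammWernerEJP2002, Thm. 1.2 (p. 2), §3 (3.1) (p. 8)] -/
theorem LawlerSchrammWerner2002_annulusCrossing_of_crossingBounds_of_tendsto_seq {C : ℝ}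
    (hC : 0 < C)
    (hb : ∀ r : ℝ, 0 < r → r < 1 / 2 → ∃ s₀ : ℝ, ∀ R : ℝ, s₀ ≤ R →
      C⁻¹ * r ^ (5 / 48 : ℝ) / 2 ≤ (triSitePercolation half).real (triOpenCrossing (r * R) R) ∧
        (triSitePercolation half).real (triOpenCrossing (r * R) R) ≤ 2 * (C * r ^ (5 / 48 : ℝ)))
    {M : ℝ} (hM1 : 1 ≤ M) (hM2 : M < 2) {R_ : ℕ → ℝ} (hR : Tendsto R_ atTop atTop)
    (hratio : ∀ᶠ k in atTop, R_ (k + 1) ≤ M * R_ k) {N : Set ℝ} (hN : N.Countable)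
    (hconv : ∀ s : ℝ, 0 < s → s < 1 / 2 → s ∉ N → ∃ c : ℝ,
      Tendsto (fun k => (triSitePercolation half).real (triOpenCrossing (s * R_ k) (R_ k)))
        atTop (𝓝 c)) :
    LawlerSchrammWerner2002_annulusCrossing := by
  refine LawlerSchrammWerner2002_annulusCrossing_of_crossingBounds_of_coherence hC hb
    fun ρ hρ0 hρ8 => ?_
  have hM0 : 0 < M := by linarith
  -- a convergence radius in the window `[Mρ, 4ρ/M]`
  have hwin : M * ρ < 4 * ρ / M := by
    rw [lt_div_iff₀ hM0]
    have hMM : M * M < 4 := by nlinarith [mul_pos hM0 (sub_pos.2 hM2)]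
    calc M * ρ * M = ρ * (M * M) := by ring
      _ < ρ * 4 := mul_lt_mul_of_pos_left hMM hρ0
      _ = 4 * ρ := by ring
  have hnc : ¬ (Icc (M * ρ) (4 * ρ / M)).Countable := by
    rw [Cardinal.Real.Icc_countable_iff, not_le]
    exact hwin
  obtain ⟨s, hs, hsN⟩ : ∃ s ∈ Icc (M * ρ) (4 * ρ / M), s ∉ N := by
    by_contra hcon
    push Not at hcon
    exact hnc (hN.mono fun x hx => hcon x hx)
  have hs0 : 0 < s := lt_of_lt_of_le (by positivity) hs.1
  have hs4 : s ≤ 4 * ρ := hs.2.trans (div_le_self (by positivity) hM1)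
  obtain ⟨q, hq⟩ := hconv s hs0 (by linarith) hsN
  have hpos : ∀ᶠ k in atTop, 0 ≤ R_ k := hR.eventually_ge_atTop 0
  have h1 : ∀ᶠ k in atTop, ρ * R_ (k + 1) ≤ s * R_ k := by
    filter_upwards [hratio, hpos] with k hk hk0
    calc ρ * R_ (k + 1) ≤ ρ * (M * R_ k) := mul_le_mul_of_nonneg_left hk hρ0.le
      _ = M * ρ * R_ k := by ring
      _ ≤ s * R_ k := mul_le_mul_of_nonneg_right hs.1 hk0
  have h2 : ∀ᶠ k in atTop, s * R_ (k + 1) ≤ 4 * ρ * R_ k := by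
    have hsM : s * M ≤ 4 * ρ := (le_div_iff₀ hM0).1 hs.2
    filter_upwards [hratio, hpos] with k hk hk0
    calc s * R_ (k + 1) ≤ s * (M * R_ k) := mul_le_mul_of_nonneg_left hk hs0.le
      _ = s * M * R_ k := by ring
      _ ≤ 4 * ρ * R_ k := mul_le_mul_of_nonneg_right hsM hk0
  obtain ⟨s₀, hs₀⟩ := hb ρ hρ0 (by linarith)
  exact coherence_of_limsup_le_of_le_liminf (by positivity : (0 : ℝ) < C⁻¹ * ρ ^ (5 / 48 : ℝ) / 2)
    ((eventually_ge_atTop s₀).mono fun R hR => (hs₀ R hR).1)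
    (limsup_le_of_tendsto_seq_triOpenCrossing hρ0.le hR h1 hq)
    (le_liminf_of_tendsto_seq_triOpenCrossing (by positivity) hR h2 hq)

/-- **Ratio `2`: convergence along one sequence of scales with `R_{k+1} ≤ 2 R_k`, at every radius
`s ∈ (0, 1/4)`** (degenerate window `s = 2ρ`), plus the uniform power bounds, give
`LawlerSchrammWerner2002_annulusCrossing`. [cite: LawlerSchrammWernerEJP2002, Thm. 1.2 (p. 2), §3 (3.1) (p. 8)] -/
theorem LawlerSchrammWerner2002_annulusCrossing_of_crossingBounds_of_tendsto_seq_two {C : ℝ}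
    (hC : 0 < C)
    (hb : ∀ r : ℝ, 0 < r → r < 1 / 2 → ∃ s₀ : ℝ, ∀ R : ℝ, s₀ ≤ R →
      C⁻¹ * r ^ (5 / 48 : ℝ) / 2 ≤ (triSitePercolation half).real (triOpenCrossing (r * R) R) ∧
        (triSitePercolation half).real (triOpenCrossing (r * R) R) ≤ 2 * (C * r ^ (5 / 48 : ℝ)))
    {R_ : ℕ → ℝ} (hR : Tendsto R_ atTop atTop) (hratio : ∀ᶠ k in atTop, R_ (k + 1) ≤ 2 * R_ k)
    (hconv : ∀ s : ℝ, 0 < s → s < 1 / 4 → ∃ c : ℝ,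
      Tendsto (fun k => (triSitePercolation half).real (triOpenCrossing (s * R_ k) (R_ k)))
        atTop (𝓝 c)) :
    LawlerSchrammWerner2002_annulusCrossing := by
  refine LawlerSchrammWerner2002_annulusCrossing_of_crossingBounds_of_coherence hC hb
    fun ρ hρ0 hρ8 => ?_
  obtain ⟨q, hq⟩ := hconv (2 * ρ) (by positivity) (by linarith)
  have h1 : ∀ᶠ k in atTop, ρ * R_ (k + 1) ≤ 2 * ρ * R_ k := by
    filter_upwards [hratio] with k hk
    calc ρ * R_ (k + 1) ≤ ρ * (2 * R_ k) := mul_le_mul_of_nonneg_left hk hρ0.le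
      _ = 2 * ρ * R_ k := by ring
  have h2 : ∀ᶠ k in atTop, 2 * ρ * R_ (k + 1) ≤ 4 * ρ * R_ k := by
    filter_upwards [hratio] with k hk
    calc 2 * ρ * R_ (k + 1) ≤ 2 * ρ * (2 * R_ k) := mul_le_mul_of_nonneg_left hk (by positivity)
      _ = 4 * ρ * R_ k := by ring
  obtain ⟨s₀, hs₀⟩ := hb ρ hρ0 (by linarith)
  exact coherence_of_limsup_le_of_le_liminf (by positivity : (0 : ℝ) < C⁻¹ * ρ ^ (5 / 48 : ℝ) / 2)
    ((eventually_ge_atTop s₀).mono fun R hR => (hs₀ R hR).1)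
    (limsup_le_of_tendsto_seq_triOpenCrossing hρ0.le hR h1 hq)
    (le_liminf_of_tendsto_seq_triOpenCrossing (by positivity) hR h2 hq)

/-- **Dyadic scales**: the uniform power bounds and the convergence of `P[C(s 2^k, 2^k)]` as
`k → ∞` for every `s ∈ (0, 1/4)` give `LawlerSchrammWerner2002_annulusCrossing`.
[cite: LawlerSchrammWernerEJP2002, Thm. 1.2 (p. 2), §3 (3.1) (p. 8)] -/
theorem LawlerSchrammWerner2002_annulusCrossing_of_crossingBounds_of_tendsto_dyadic {C : ℝ}
    (hC : 0 < C)
    (hb : ∀ r : ℝ, 0 < r → r < 1 / 2 → ∃ s₀ : ℝ, ∀ R : ℝ, s₀ ≤ R →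
      C⁻¹ * r ^ (5 / 48 : ℝ) / 2 ≤ (triSitePercolation half).real (triOpenCrossing (r * R) R) ∧
        (triSitePercolation half).real (triOpenCrossing (r * R) R) ≤ 2 * (C * r ^ (5 / 48 : ℝ)))
    (hconv : ∀ s : ℝ, 0 < s → s < 1 / 4 → ∃ c : ℝ,
      Tendsto (fun k : ℕ => (triSitePercolation half).real
        (triOpenCrossing (s * (2 : ℝ) ^ k) ((2 : ℝ) ^ k))) atTop (𝓝 c)) :
    LawlerSchrammWerner2002_annulusCrossing :=
  LawlerSchrammWerner2002_annulusCrossing_of_crossingBounds_of_tendsto_seq_two hC hb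
    (R_ := fun k : ℕ => (2 : ℝ) ^ k) (tendsto_pow_atTop_atTop_of_one_lt one_lt_two)
    (Eventually.of_forall fun k => (pow_succ' (2 : ℝ) k).le) hconv

/-! ### Weak convergence of the hull laws along a sequence -/

/-- **Weak convergence along a sequence gives radial convergence along it** (the sequence
version of `tendsto_real_triOpenCrossing_of_scalingLimit`): if `lswLaw (R_k) → ν` weakly with
`R_k → ∞`, then for every `s ∈ (0, 1)` that is not an atom of `dist(0, K)` under `ν` — all but
countably many — `P[C(sR_k, R_k)] = P[Q_{1/R_k} ∈ meetsBall s] → ν(meetsBall s)` (portmanteau at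
the `ν`-continuity set `{dist(0, K) < s}`). [cite: Billingsley1999, Thm 2.1] -/
theorem tendsto_real_triOpenCrossing_seq_of_tendsto_lswLaw {R_ : ℕ → ℝ}
    (hR : Tendsto R_ atTop atTop) {ν : ProbabilityMeasure (NonemptyCompacts ℂ)}
    (hν : Tendsto (lswLaw ∘ R_) atTop (𝓝 ν)) :
    ∃ N : Set ℝ, N.Countable ∧ ∀ s : ℝ, 0 < s → s < 1 → s ∉ N →
      Tendsto (fun k => (triSitePercolation half).real (triOpenCrossing (s * R_ k) (R_ k))) atTop
        (𝓝 ((ν : Measure (NonemptyCompacts ℂ)).real (meetsBall s))) := by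
  refine ⟨{r | 0 < (ν : Measure (NonemptyCompacts ℂ))
      {K : NonemptyCompacts ℂ | infDist (0 : ℂ) (K : Set ℂ) = r}},
    Measure.countable_meas_level_set_pos continuous_infDist_zero_nonemptyCompacts.measurable,
    fun s _ hs1 hsN => ?_⟩
  have hsub : frontier (meetsBall s) ⊆
      {K : NonemptyCompacts ℂ | infDist (0 : ℂ) (K : Set ℂ) = s} :=
    frontier_lt_subset_eq (f := fun K : NonemptyCompacts ℂ => infDist (0 : ℂ) (K : Set ℂ))
      (g := fun _ => s) continuous_infDist_zero_nonemptyCompacts continuous_const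
  have hnull : (ν : Measure (NonemptyCompacts ℂ)) (frontier (meetsBall s)) = 0 :=
    measure_mono_null hsub (nonpos_iff_eq_zero.1 (not_lt.1 hsN))
  have ht := ProbabilityMeasure.tendsto_measure_of_null_frontier_of_tendsto' hν hnull
  rw [measureReal_def]
  refine ((ENNReal.tendsto_toReal (measure_ne_top _ _)).comp ht).congr' ?_
  filter_upwards [hR.eventually_gt_atTop 0] with k hk
  rw [Function.comp_apply, Function.comp_apply, real_triOpenCrossing_eq hs1.le hk]

/-- **The fact from uniform power bounds and the weak convergence of the hull laws along one
sequence of scales with ratios `< 2`.** If `C⁻¹ r^{5/48}/2 ≤ P[C(rR, R)] ≤ 2 C r^{5/48}` for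
`r ∈ (0, 1/2)` and large `R`, and `lswLaw (R_k) → ν` weakly along some `R_k → ∞` with
`R_{k+1} ≤ M R_k` eventually, `1 ≤ M < 2` (e.g. `R_k = (3/2)^k`), then
`LawlerSchrammWerner2002_annulusCrossing` holds
(`tendsto_real_triOpenCrossing_seq_of_tendsto_lswLaw` and
`LawlerSchrammWerner2002_annulusCrossing_of_crossingBounds_of_tendsto_seq`). The existence of the
scaling limit (`R → ∞` through `ℝ`, LSW p. 3) implies the hypothesis, e.g. along
`R_k = k + 2` with `M = 3/2` (`LawlerSchrammWerner2002_annulusCrossing_of_crossingBounds_of_scalingLimit`).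
[cite: LawlerSchrammWernerEJP2002, Thm. 1.2 (p. 2), §2 (p. 3), §3 (3.1) (p. 8)] -/
theorem LawlerSchrammWerner2002_annulusCrossing_of_crossingBounds_of_tendsto_lswLaw_seq {C : ℝ}
    (hC : 0 < C)
    (hb : ∀ r : ℝ, 0 < r → r < 1 / 2 → ∃ s₀ : ℝ, ∀ R : ℝ, s₀ ≤ R →
      C⁻¹ * r ^ (5 / 48 : ℝ) / 2 ≤ (triSitePercolation half).real (triOpenCrossing (r * R) R) ∧
        (triSitePercolation half).real (triOpenCrossing (r * R) R) ≤ 2 * (C * r ^ (5 / 48 : ℝ)))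
    {M : ℝ} (hM1 : 1 ≤ M) (hM2 : M < 2) {R_ : ℕ → ℝ} (hR : Tendsto R_ atTop atTop)
    (hratio : ∀ᶠ k in atTop, R_ (k + 1) ≤ M * R_ k) {ν : ProbabilityMeasure (NonemptyCompacts ℂ)}
    (hν : Tendsto (lswLaw ∘ R_) atTop (𝓝 ν)) :
    LawlerSchrammWerner2002_annulusCrossing := by
  obtain ⟨N, hN, hconv⟩ := tendsto_real_triOpenCrossing_seq_of_tendsto_lswLaw hR hν
  exact LawlerSchrammWerner2002_annulusCrossing_of_crossingBounds_of_tendsto_seq hC hb hM1 hM2 hR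
    hratio hN fun s hs0 hs2 hsN => ⟨_, hconv s hs0 (by linarith) hsN⟩

/-- Consistency with the printed hypothesis: the existence of the scaling limit (LSW §2, p. 3;
weak convergence of `lswLaw R` as `R → ∞` through `ℝ`, hypothesis `hsl`) gives weak convergence along
`R_k = k + 2`, whose ratios are `≤ 3/2`, so with the uniform power bounds it implies the fact
through `LawlerSchrammWerner2002_annulusCrossing_of_crossingBounds_of_tendsto_lswLaw_seq`.
[cite: LawlerSchrammWernerEJP2002, §2 (p. 3), §3 (3.1) (p. 8)] -/
theorem LawlerSchrammWerner2002_annulusCrossing_of_crossingBounds_of_scalingLimit {C : ℝ}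
    (hC : 0 < C)
    (hb : ∀ r : ℝ, 0 < r → r < 1 / 2 → ∃ s₀ : ℝ, ∀ R : ℝ, s₀ ≤ R →
      C⁻¹ * r ^ (5 / 48 : ℝ) / 2 ≤ (triSitePercolation half).real (triOpenCrossing (r * R) R) ∧
        (triSitePercolation half).real (triOpenCrossing (r * R) R) ≤ 2 * (C * r ^ (5 / 48 : ℝ)))
    (hsl : ∃ ν : ProbabilityMeasure (NonemptyCompacts ℂ), Tendsto lswLaw atTop (𝓝 ν)) :
    LawlerSchrammWerner2002_annulusCrossing := by
  obtain ⟨ν, hν⟩ := hsl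
  have hR : Tendsto (fun k : ℕ => (k : ℝ) + 2) atTop atTop :=
    tendsto_atTop_add_const_right _ _ tendsto_natCast_atTop_atTop
  refine LawlerSchrammWerner2002_annulusCrossing_of_crossingBounds_of_tendsto_lswLaw_seq hC hb
    (M := 3 / 2) (by norm_num) (by norm_num) hR (Eventually.of_forall fun k => ?_) (hν.comp hR)
  push_cast
  linarith [(k.cast_nonneg : (0 : ℝ) ≤ k)]

/-- **The fact from LSW §2 at subsequential limits and weak convergence along one sequence of
scales with ratios `< 2`.** Assume the subsequential hitting-PDE hypotheses of
`oneArm_exponent_of_subseqHittingPDE` (`H : IsHittingPDEData h h_θ h_θθ h_t` identified through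
(2.2) at `θ = 2π` with every subsequential weak limit of `lswLaw`, `hid`) and that `lswLaw (R_k)`
converges weakly along some `R_k → ∞` with `R_{k+1} ≤ M R_k` eventually, `1 ≤ M < 2`. Then
`LawlerSchrammWerner2002_annulusCrossing` holds: `IsHittingPDEData.measure_bounds` (Koebe
constant `koebeCovering_const`) and `crossingBounds_of_subseqLimits` give the uniform power bounds.
Compare `LawlerSchrammWerner2002_annulusCrossing_of_scalingLimit_of_subseqHittingPDE`, which
assumes the scaling limit through `ℝ`. [cite: LawlerSchrammWernerEJP2002, Thm. 1.2 (p. 2), §2, §3 (3.1) (p. 8)] -/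
theorem LawlerSchrammWerner2002_annulusCrossing_of_subseqHittingPDE_of_tendsto_lswLaw_seq
    {h hθ hθθ ht : ℝ → ℝ → ℝ} (H : IsHittingPDEData h hθ hθθ ht)
    (hid : ∀ (R : ℕ → ℝ) (ν : ProbabilityMeasure (NonemptyCompacts ℂ)),
      Tendsto R atTop atTop → Tendsto (lswLaw ∘ R) atTop (𝓝 ν) →
        ∀ t, h (2 * Real.pi) t = (ν : Measure (NonemptyCompacts ℂ)).real
          {K | Literature.Analysis.Complex.conformalRadius (K : Set ℂ) ≤ Real.exp (-t)})
    {M : ℝ} (hM1 : 1 ≤ M) (hM2 : M < 2) {R_ : ℕ → ℝ} (hR : Tendsto R_ atTop atTop)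
    (hratio : ∀ᶠ k in atTop, R_ (k + 1) ≤ M * R_ k) {ν : ProbabilityMeasure (NonemptyCompacts ℂ)}
    (hν : Tendsto (lswLaw ∘ R_) atTop (𝓝 ν)) :
    LawlerSchrammWerner2002_annulusCrossing := by
  obtain ⟨C, hC, hb⟩ := H.measure_bounds koebeCovering_const (by positivity)
  have hlim : ∀ (R : ℕ → ℝ) (ν : ProbabilityMeasure (NonemptyCompacts ℂ)),
      Tendsto R atTop atTop → Tendsto (lswLaw ∘ R) atTop (𝓝 ν) →
        ∀ r : ℝ, 0 < r → r < 1 / 2 →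
          C⁻¹ * r ^ (5 / 48 : ℝ) ≤ (ν : Measure (NonemptyCompacts ℂ)).real (meetsBall r) ∧
            (ν : Measure (NonemptyCompacts ℂ)).real (meetsClosedBall r) ≤ C * r ^ (5 / 48 : ℝ) :=
    fun R ν hR hν => hb ν (hid R ν hR hν)
  exact LawlerSchrammWerner2002_annulusCrossing_of_crossingBounds_of_tendsto_lswLaw_seq hC
    (fun r hr0 hr2 => crossingBounds_of_subseqLimits hC hlim hr0 hr2) hM1 hM2 hR hratio hν

end Literature.Probability.Percolation
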